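import Mathlib
import Summits.ValiantsHypothesis.ValiantsHypothesis.Theses.ValuativeGCT
import Literature.Computability.AlgebraicComplexity.OrbitClosureWeights
import Literature.Computability.AlgebraicComplexity.MultiplicityObstructionsProofs
import Literature.Computability.AlgebraicComplexity.GateQuotients
/-!
# Hilbert-function lower bound from the tangent rank (B3)

Stub `stub_hilbertLowerBound` of line `skew-restriction-rank` for crux `ValuativeGCT.ValuativeFlip`
(stmt-ValiantsHypothesis-12624): for a nonzero form `f` of degree `m` whose tangent span
`span{x_a ∂_b f}` has dimension `≥ N + 1`, `dim genericOrbitMap_f(ℂ[Sym^m]_δ) ≥ C(δ + N, N)`.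
Method: initial forms at `A = 1` — after the translation `A ↦ 1 + A` (`hlbτ`) the image of `X_d`
has constant term `coeff_d f` and linear part the row `d` of the tangent matrix
`M[d,(a,b)] = coeff_d (x_a ∂_b f)` (`hlb_expansion`); row rank = column rank; the degree-`δ`
monomials in `N + 1` suitable combinations have linearly independent lowest-degree forms. -/

set_option linter.dupNamespace false

namespace Summit.ValiantsHypothesis.ValiantsHypothesis.Theorems.ValuativeFlip

open MvPolynomial
open scoped BigOperators Matrix
open Literature.NumberTheory.DiophantineGeometry
open Literature.Computability.AlgebraicComplexity

noncomputable section

/-- `hlbτ⟦σ⟧`: the translation `A ↦ 1 + A` on `ℂ[Mat_σ]`, i.e. the `ℂ`-algebra endomorphism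
`X p ↦ X p + δ_{p.1 p.2}` of `MvPolynomial (σ × σ) ℂ`. -/
local notation3 "hlbτ⟦" s "⟧" =>
  (MvPolynomial.aeval (R := ℂ) fun p : s × s => X p + C (if p.1 = p.2 then (1 : ℂ) else 0))

/-- `hlbW⟦σ⟧`: the substitution `x_i ↦ ∑_j (A_{ji} + δ_{ji}) x_j` (generic linear substitution
translated to the identity matrix), coefficients in `ℂ[A] = MvPolynomial (σ × σ) ℂ`. -/
local notation3 "hlbW⟦" s "⟧" => (fun i : s => ∑ j : s,
  ((Matrix.mvPolynomialX s s ℂ).map (hlbτ⟦s⟧).toRingHom) j i •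
    (X j : MvPolynomial s (MvPolynomial (s × s) ℂ)))

/-- `hlbM⟦σ, f, m⟧`: the tangent matrix `M[d, (a,b)] = coeff_d (x_a ∂_b f)` of `f` in degree `m`. -/
local notation3 "hlbM⟦" s ", " f ", " m "⟧" =>
  (Matrix.of fun (d : DegIdx s m) (p : s × s) => coeff d.1 (X p.1 * pderiv p.2 f))

section Graded

variable {ι K : Type*} [CommSemiring K]

/-- Lowest-degree forms multiply: if `a` has no homogeneous components below degree `p` and `b`
none below `q`, then `a * b` has none below `p + q`, where its component is the product of the
lowest components of `a` and `b`. [folklore] -/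
theorem hlbOrd_mul {p q : ℕ} {a b : MvPolynomial ι K} (ha : ∀ j < p, homogeneousComponent j a = 0)
    (hb : ∀ j < q, homogeneousComponent j b = 0) :
    (∀ j < p + q, homogeneousComponent j (a * b) = 0) ∧ homogeneousComponent (p + q) (a * b) =
      homogeneousComponent p a * homogeneousComponent q b := by
  have key : ∀ n i, (p ≤ i → n - i < q) →
      homogeneousComponent i a * homogeneousComponent (n - i) b = 0 := fun n i h => by
    by_cases hi : i < p
    · rw [ha i hi, zero_mul]
    · rw [hb (n - i) (h (not_lt.mp hi)), mul_zero]
  refine ⟨fun n hn => ?_, ?_⟩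
  · rw [DepthReduction.homogeneousComponent_mul]
    exact Finset.sum_eq_zero fun i hi => key n i fun _ => by
      have := Finset.mem_range.mp hi; omega
  · rw [DepthReduction.homogeneousComponent_mul, Finset.sum_eq_single p
      (fun i hi hip => key (p + q) i fun h => by have := Finset.mem_range.mp hi; omega)
      (fun h => absurd (Finset.mem_range.mpr (by omega)) h), Nat.add_sub_cancel_left]

/-- Lowest-degree forms of a finite product. [folklore] -/
theorem hlbOrd_prod {α : Type*} (s : Finset α) (p : α → ℕ) (a : α → MvPolynomial ι K)
    (h : ∀ i ∈ s, ∀ j < p i, homogeneousComponent j (a i) = 0) :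
    (∀ j < ∑ i ∈ s, p i, homogeneousComponent j (∏ i ∈ s, a i) = 0) ∧
      homogeneousComponent (∑ i ∈ s, p i) (∏ i ∈ s, a i) =
        ∏ i ∈ s, homogeneousComponent (p i) (a i) := by
  classical
  induction s using Finset.induction_on with
  | empty => simp
  | insert i s hi ih =>
    rw [Finset.sum_insert hi, Finset.prod_insert hi, Finset.prod_insert hi]
    obtain ⟨h1, h2⟩ := ih fun j hj => h j (Finset.mem_insert_of_mem hj)
    obtain ⟨h3, h4⟩ := hlbOrd_mul (h i (Finset.mem_insert_self i s)) h1
    exact ⟨h3, by rw [h4, h2]⟩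

/-- Lowest-degree form of a power. [folklore] -/
theorem hlbOrd_pow {p : ℕ} {a : MvPolynomial ι K} (ha : ∀ j < p, homogeneousComponent j a = 0)
    (n : ℕ) : (∀ j < n * p, homogeneousComponent j (a ^ n) = 0) ∧
      homogeneousComponent (n * p) (a ^ n) = homogeneousComponent p a ^ n := by
  simpa only [Finset.sum_const, Finset.card_range, smul_eq_mul, Finset.prod_const] using
    hlbOrd_prod (Finset.range n) (fun _ => p) (fun _ => a) fun _ _ => ha

/-- The components of degree `0` and `1` of `X p * r`. [folklore] -/
theorem hlb_hc_X_mul (p : ι) (r : MvPolynomial ι K) :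
    homogeneousComponent 0 (X p * r) = 0 ∧
      homogeneousComponent 1 (X p * r) = X p * homogeneousComponent 0 r := by
  have hX : ∀ j < 1, homogeneousComponent j (X p : MvPolynomial ι K) = 0 := fun j hj => by
    rw [homogeneousComponent_of_mem (isHomogeneous_X K p), if_neg (by omega)]
  obtain ⟨h1, h2⟩ := hlbOrd_mul hX fun j hj => absurd hj (Nat.not_lt_zero j)
  exact ⟨h1 0 Nat.zero_lt_one, by rw [h2, homogeneousComponent_eq_self (isHomogeneous_X K p)]⟩

end Graded

/-- **Initial-forms lemma.** If the lowest-degree forms `homogeneousComponent (n s) (P s)` of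
polynomials `P s` with no components below degree `n s` are linearly independent, so are the `P s`.
[folklore] -/
theorem hlb_linearIndependent_of_initialForms {K : Type*} [Field K] {ι S : Type*} [Fintype S]
    (P φ : S → MvPolynomial ι K) (n : S → ℕ) (hφ : LinearIndependent K φ)
    (hlow : ∀ s, ∀ j < n s, homogeneousComponent j (P s) = 0)
    (hin : ∀ s, homogeneousComponent (n s) (P s) = φ s) : LinearIndependent K P := by
  rw [Fintype.linearIndependent_iff] at hφ ⊢
  intro g hg
  suffices key : ∀ j, ∀ s, n s < j → g s = 0 from fun s => key (n s + 1) s (Nat.lt_succ_self _)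
  intro j
  induction j with
  | zero => exact fun s hs => absurd hs (Nat.not_lt_zero _)
  | succ j ih =>
    have H : ∑ s, (if n s = j then g s else 0) • φ s = 0 := by
      rw [← (homogeneousComponent j).map_zero, ← hg, map_sum]
      refine Finset.sum_congr rfl fun s _ => ?_
      rw [map_smul]
      split_ifs with hs
      · rw [← hs, hin]
      · rcases lt_or_gt_of_ne hs with hs | hs
        · rw [ih s hs, zero_smul, zero_smul]
        · rw [hlow s j hs, smul_zero, zero_smul]
    intro s hs
    rcases Nat.lt_succ_iff_lt_or_eq.mp hs with h | h
    · exact ih s h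
    · simpa [h] using hφ _ H s

/-- Linearly independent linear forms `∑_p A k p • X p` (`k < N`) are algebraically independent:
the substitution `X k ↦ ∑_p A k p • X p` is injective (evaluation is onto `ℂ^N`). [folklore] -/
theorem hlb_aeval_injective_of_linearIndependent {ι : Type*} [Fintype ι] {N : ℕ}
    (A : Matrix (Fin N) ι ℂ) (hA : LinearIndependent ℂ A.row) :
    Function.Injective (aeval (fun k => ∑ p, A k p • (X p : MvPolynomial ι ℂ)) :
      MvPolynomial (Fin N) ℂ →ₐ[ℂ] MvPolynomial ι ℂ) := by
  have hsurj : Function.Surjective A.mulVecLin := by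
    rw [← LinearMap.range_eq_top]
    apply Submodule.eq_top_of_finrank_eq
    change A.rank = _
    rw [hA.rank_matrix, Module.finrank_fintype_fun_eq_card]
  refine (injective_iff_map_eq_zero _).mpr fun F hF => MvPolynomial.funext fun y => ?_
  obtain ⟨z, hz⟩ := hsurj y
  have hfun : (fun k => aeval z (∑ p, A k p • (X p : MvPolynomial ι ℂ))) = y := by
    funext k
    rw [← hz, Matrix.mulVecLin_apply, Matrix.mulVec, dotProduct]
    simp only [map_sum, map_smul, aeval_X, smul_eq_mul]
  rw [map_zero, show eval y F = aeval z (aeval _ F) by rw [← AlgHom.comp_apply, comp_aeval, hfun]; rfl,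
    hF, map_zero]

/-! ### First-order expansion of the generic orbit map at the identity -/

section Expansion

variable {σ : Type*} [Fintype σ] [LinearOrder σ]

/-- **First-order expansion at the identity.** For `g ∈ ℂ[x_σ]` and an exponent `d`, the
coefficient of `x^d` in `g(…, ∑_j (A_{ji} + δ_{ji}) x_j, …)` (a polynomial in the matrix entries)
has constant term `coeff_d g` and linear part `∑_{(a,b)} coeff_d (x_a ∂_b g) · A_{(a,b)}`. [folklore] -/
theorem hlb_expansion (g : MvPolynomial σ ℂ) (d : σ →₀ ℕ) :
    homogeneousComponent 0 (coeff d (aeval (hlbW⟦σ⟧) g)) = C (coeff d g) ∧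
      homogeneousComponent 1 (coeff d (aeval (hlbW⟦σ⟧) g)) =
        ∑ p : σ × σ, coeff d (X p.1 * pderiv p.2 g) • (X p : MvPolynomial (σ × σ) ℂ) := by
  induction g using MvPolynomial.induction_on generalizing d with
  | C a =>
    simp only [pderiv_C, mul_zero, coeff_zero, zero_smul, Finset.sum_const_zero, aeval_C,
      MvPolynomial.algebraMap_apply, algebraMap_eq, coeff_C]
    by_cases hd : 0 = d <;> simp [hd, homogeneousComponent_of_mem (isHomogeneous_C (σ × σ) a)]
  | add p q hp hq =>
    simp only [map_add, coeff_add, (hp d).1, (hp d).2, (hq d).1, (hq d).2, mul_add, add_smul,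
      Finset.sum_add_distrib, and_self]
  | mul_X g i hg =>
    have hL : ∑ p : σ × σ, coeff d (X p.1 * pderiv p.2 (g * X i)) • (X p : MvPolynomial (σ × σ) ℂ) =
        ∑ p : σ × σ, coeff d (X p.1 * pderiv p.2 g * X i) • (X p : MvPolynomial (σ × σ) ℂ) +
          ∑ j, coeff d (g * X j) • (X (j, i) : MvPolynomial (σ × σ) ℂ) := by
      simp only [pderiv_mul, mul_add, coeff_add, add_smul, Finset.sum_add_distrib, mul_assoc]
      congr 1
      rw [Fintype.sum_prod_type]
      refine Finset.sum_congr rfl fun j _ => ?_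
      rw [Finset.sum_eq_single i (fun k _ hk => by rw [pderiv_X_of_ne hk.symm, mul_zero,
        mul_zero, coeff_zero, zero_smul]) (fun h => absurd (Finset.mem_univ i) h),
        pderiv_X_self, mul_one, mul_comm]
    set t : σ → MvPolynomial (σ × σ) ℂ := fun j => if j ∈ d.support then
      coeff (d - Finsupp.single j 1) (aeval (hlbW⟦σ⟧) g) else 0 with ht
    have ht01 : ∀ j, homogeneousComponent 0 (t j) = C (coeff d (g * X j)) ∧
        homogeneousComponent 1 (t j) = ∑ p : σ × σ,
          coeff d (X p.1 * pderiv p.2 g * X j) • (X p : MvPolynomial (σ × σ) ℂ) := fun j => by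
      simp only [ht, coeff_mul_X']
      split_ifs with h
      · exact hg _
      · simp
    have hexp : coeff d (aeval (hlbW⟦σ⟧) (g * X i)) =
        ∑ j, (X (j, i) + C (if j = i then (1 : ℂ) else 0)) * t j := by
      rw [map_mul, aeval_X, Finset.mul_sum, coeff_sum]
      refine Finset.sum_congr rfl fun j _ => ?_
      have hτ : (hlbτ⟦σ⟧).toRingHom (X (j, i)) = X (j, i) + C (if j = i then 1 else 0) :=
        aeval_X _ _
      rw [mul_smul_comm, coeff_smul, coeff_mul_X', smul_eq_mul, Matrix.map_apply,
        Matrix.mvPolynomialX_apply, hτ]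
    have hδ : ∀ F : σ → MvPolynomial (σ × σ) ℂ,
        ∑ j, C (if j = i then (1 : ℂ) else 0) * F j = F i := fun F => by
      rw [Finset.sum_eq_single i (fun j _ hj => by rw [if_neg hj, C_0, zero_mul])
        (fun h => absurd (Finset.mem_univ i) h), if_pos rfl, C_1, one_mul]
    rw [hexp, hL, map_sum, map_sum]
    simp only [add_mul, map_add, (hlb_hc_X_mul _ _).1, (hlb_hc_X_mul _ _).2,
      homogeneousComponent_C_mul, (ht01 _).1, (ht01 _).2, zero_add, Finset.sum_add_distrib, hδ,
      true_and]
    rw [add_comm]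
    exact congrArg _ (Finset.sum_congr rfl fun j _ => by rw [smul_eq_C_mul, mul_comm])

/-- Constant term `∑_d a_d coeff_d f` and linear part (coefficient vector `a ᵥ* M`) of the
translated generic orbit map on a linear form `∑_d a_d X_d` in the coordinates, via
`τ (genericOrbitMap f m (X d)) = coeff_d f(…, ∑_j (A_{ji} + δ_{ji}) x_j, …)` and `hlb_expansion`. [folklore] -/
theorem hlb_hc_lin (f : MvPolynomial σ ℂ) (m : ℕ) (a : DegIdx σ m → ℂ) :
    homogeneousComponent 0 (hlbτ⟦σ⟧ (genericOrbitMap f m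
        (∑ d, a d • (X d : MvPolynomial (DegIdx σ m) ℂ)))) = C (∑ d, a d * coeff d.1 f) ∧
      homogeneousComponent 1 (hlbτ⟦σ⟧ (genericOrbitMap f m
        (∑ d, a d • (X d : MvPolynomial (DegIdx σ m) ℂ)))) =
        ∑ p : σ × σ, (a ᵥ* hlbM⟦σ, f, m⟧) p • (X p : MvPolynomial (σ × σ) ℂ) := by
  have hX (d : DegIdx σ m) : hlbτ⟦σ⟧ (genericOrbitMap f m (X d)) = coeff d.1 (aeval (hlbW⟦σ⟧) f) := by
    have hC : (hlbτ⟦σ⟧).toRingHom.comp (C : ℂ →+* MvPolynomial (σ × σ) ℂ) =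
        algebraMap ℂ (MvPolynomial (σ × σ) ℂ) := RingHom.ext fun a => (hlbτ⟦σ⟧).commutes a
    have h2 (Φ : MvPolynomial σ (MvPolynomial (σ × σ) ℂ)) (e : σ →₀ ℕ) :
        hlbτ⟦σ⟧ (coeff e Φ) = coeff e (map (hlbτ⟦σ⟧).toRingHom Φ) := by rw [coeff_map]; rfl
    rw [show genericOrbitMap f m (X d) = _ from aeval_X _ _, h2, map_linSubst, map_map, hC,
      linSubst, aeval_map_algebraMap]
  have h0 := fun d : DegIdx σ m => (hlb_expansion f d.1).1
  have h1 := fun d : DegIdx σ m => (hlb_expansion f d.1).2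
  simp only [map_sum, map_smul, hX, h0, h1]
  constructor
  · exact Finset.sum_congr rfl fun d _ => by rw [map_mul, smul_eq_C_mul]
  · simp only [Finset.smul_sum, smul_smul]
    rw [Finset.sum_comm]
    refine Finset.sum_congr rfl fun p _ => ?_
    rw [← Finset.sum_smul]
    rfl

/-- **Rank transfer.** The row space of the tangent matrix has the dimension of the tangent span
`span{x_a ∂_b f}` (row rank = column rank; the columns are the coefficient vectors). [folklore] -/
theorem hlb_finrank_span_row_hlbM {f : MvPolynomial σ ℂ} {m : ℕ} (hf : f.IsHomogeneous m) :
    Module.finrank ℂ (Submodule.span ℂ (Set.range (hlbM⟦σ, f, m⟧).row)) =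
      Module.finrank ℂ (Submodule.span ℂ (Set.range fun ab : σ × σ => X ab.1 * pderiv ab.2 f)) := by
  have hhom : ∀ ab : σ × σ, (X ab.1 * pderiv ab.2 f).IsHomogeneous m := fun ab => by
    obtain _ | m := m
    · rw [← totalDegree_zero_iff_isHomogeneous, totalDegree_eq_zero_iff_eq_C] at hf
      rw [hf, pderiv_C, mul_zero]
      exact isHomogeneous_zero _ _ _
    · simpa [add_comm] using (isHomogeneous_X ℂ ab.1).mul (hf.pderiv (i := ab.2))
  set φ := Fintype.linearCombination ℂ
    (fun d : DegIdx σ m => (monomial d.1 (1 : ℂ) : MvPolynomial σ ℂ)) with hφ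
  have hinj : Function.Injective φ := by
    rw [hφ, ← linearIndependent_iff_injective_fintypeLinearCombination]
    have h := (basisMonomials σ ℂ).linearIndependent
    rw [coe_basisMonomials] at h
    exact h.comp (fun d : DegIdx σ m => d.1) Subtype.val_injective
  have hcol : (fun ab : σ × σ => X ab.1 * pderiv ab.2 f) = φ ∘ (hlbM⟦σ, f, m⟧).col := by
    funext ab
    rw [Function.comp_apply, hφ, Fintype.linearCombination_apply]
    exact (sum_coeff_smul_monomial_eq (hhom ab)).symm
  rw [hcol, Set.range_comp, Submodule.span_image, ← Matrix.rank_eq_finrank_span_row,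
    Matrix.rank_eq_finrank_span_cols]
  exact (Submodule.equivMapOfInjective φ hinj _).finrank_eq

end Expansion

/-- **Hilbert-function lower bound from the tangent rank** (stub B3 of line
`skew-restriction-rank`): for a nonzero form `f` of degree `m` whose tangent span
`span{x_a ∂_b f}` has dimension `≥ N + 1`, the degree-`δ` piece `genericOrbitMap f m (ℂ[Sym^m]_δ)`
of the coordinate ring of the orbit closure has dimension `≥ C(δ + N, N)` (initial forms at
`A = 1`: degree-`δ` monomials in `N + 1` suitable translated linear forms have linearly
independent lowest-degree forms). [folklore] -/
theorem stub_hilbertLowerBound (σ : Type) [Fintype σ] [LinearOrder σ]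
    (f : MvPolynomial σ ℂ) (m : ℕ) (hf : f.IsHomogeneous m) (hf0 : f ≠ 0) (N δ : ℕ)
    (hN : N + 1 ≤ Module.finrank ℂ ↥(Submodule.span ℂ (Set.range fun ab : σ × σ =>
        MvPolynomial.X ab.1 * MvPolynomial.pderiv ab.2 f))) :
    Nat.choose (δ + N) N ≤ Module.finrank ℂ ↥((MvPolynomial.homogeneousSubmodule (DegIdx σ m) ℂ δ).map
        (genericOrbitMap f m).toLinearMap) := by
  classical
  -- a coordinate `d₀` with nonzero coefficient `κ₀`; the tangent matrix `Λ₀` on coefficient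
  -- vectors; the constant-term functional `kap` and its kernel `K`
  obtain ⟨d0', hκ₀⟩ := MvPolynomial.ne_zero_iff.mp hf0
  set d₀ : DegIdx σ m :=
    ⟨d0', mem_degMonomials_iff.mpr (by rw [Finsupp.degree_eq_weight_one]; exact hf hκ₀)⟩
  set κ₀ : ℂ := coeff d0' f
  set Λ₀ : (DegIdx σ m → ℂ) →ₗ[ℂ] (σ × σ → ℂ) := (hlbM⟦σ, f, m⟧).vecMulLinear with hΛ₀
  set kap : (DegIdx σ m → ℂ) →ₗ[ℂ] ℂ := Fintype.linearCombination ℂ (fun d => coeff d.1 f) with hkap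
  have hkap_apply : ∀ a, kap a = ∑ d, a d * coeff d.1 f := fun a => by
    simp only [hkap, Fintype.linearCombination_apply, smul_eq_mul]
  set K : Submodule ℂ (DegIdx σ m → ℂ) := LinearMap.ker kap with hK
  set e₀ : DegIdx σ m → ℂ := Pi.single d₀ 1 with he₀
  have hkap_e₀ : kap e₀ = κ₀ := by
    rw [he₀, hkap, Fintype.linearCombination_apply_single, one_smul]
  -- Step 1: the rows `Λ₀ a`, `a ∈ K`, span a space of dimension `≥ N`
  have hle : LinearMap.range Λ₀ ≤ K.map Λ₀ ⊔ ℂ ∙ (Λ₀ e₀) := by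
    rintro _ ⟨a, rfl⟩
    rw [show a = (a - (kap a / κ₀) • e₀) + (kap a / κ₀) • e₀ by rw [sub_add_cancel], map_add,
      LinearMap.map_smul]
    refine Submodule.add_mem_sup (Submodule.mem_map_of_mem ?_)
      (Submodule.smul_mem _ _ (Submodule.mem_span_singleton_self _))
    rw [hK, LinearMap.mem_ker, map_sub, LinearMap.map_smul, hkap_e₀, smul_eq_mul,
      div_mul_cancel₀ _ hκ₀, sub_self]
  have hKN : N ≤ Module.finrank ℂ (K.map Λ₀) := by
    have h0 : N + 1 ≤ Module.finrank ℂ (LinearMap.range Λ₀) := by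
      rw [hΛ₀, range_vecMulLinear, hlb_finrank_span_row_hlbM hf]
      exact hN
    have h1 := Submodule.finrank_mono hle
    have h2 := Submodule.finrank_add_le_finrank_add_finrank (K.map Λ₀) (ℂ ∙ (Λ₀ e₀))
    have h3 : Module.finrank ℂ (ℂ ∙ (Λ₀ e₀)) ≤ 1 :=
      (finrank_span_le_card ({Λ₀ e₀} : Set (σ × σ → ℂ))).trans (by simp)
    omega
  -- Step 2: `N` such vectors `a k` with linearly independent rows `A k = Λ₀ (a k)`
  obtain ⟨b, hb⟩ := exists_linearIndependent_of_le_finrank hKN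
  have hbmem : ∀ k, ∃ a ∈ K, Λ₀ a = (b k : σ × σ → ℂ) := fun k => Submodule.mem_map.mp (b k).2
  choose a haK haΛ using hbmem
  set A : Matrix (Fin N) (σ × σ) ℂ := Matrix.of fun k => (b k : σ × σ → ℂ)
  have hinj := hlb_aeval_injective_of_linearIndependent A
    (hb.map' (K.map Λ₀).subtype (Submodule.ker_subtype _))
  set L : Fin N → MvPolynomial (σ × σ) ℂ := fun k => ∑ p, A k p • X p
  -- Step 3: the `N + 1` translated linear forms `w k`; lowest-degree forms `lead k` in degree `pdeg k`
  set avec : Fin (N + 1) → (DegIdx σ m → ℂ) :=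
    (Fin.cons (κ₀⁻¹ • e₀) a : Fin (N + 1) → DegIdx σ m → ℂ) with havec
  set lin : (DegIdx σ m → ℂ) → MvPolynomial (DegIdx σ m) ℂ := fun c => ∑ d, c d • X d
  set G : MvPolynomial (DegIdx σ m) ℂ →ₐ[ℂ] MvPolynomial (σ × σ) ℂ := (hlbτ⟦σ⟧).comp (genericOrbitMap f m)
  set w : Fin (N + 1) → MvPolynomial (σ × σ) ℂ := fun k => G (lin (avec k)) with hw
  set pdeg : Fin (N + 1) → ℕ := (Fin.cons 0 (fun _ => 1) : Fin (N + 1) → ℕ) with hpdeg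
  set lead : Fin (N + 1) → MvPolynomial (σ × σ) ℂ :=
    (Fin.cons 1 L : Fin (N + 1) → MvPolynomial (σ × σ) ℂ) with hlead
  have hwk : ∀ k, (∀ j < pdeg k, homogeneousComponent j (w k) = 0) ∧
      homogeneousComponent (pdeg k) (w k) = lead k := fun k => by
    have h01 : homogeneousComponent 0 (w k) = C (kap (avec k)) ∧ homogeneousComponent 1 (w k) =
        ∑ p : σ × σ, Λ₀ (avec k) p • (X p : MvPolynomial (σ × σ) ℂ) := by
      rw [hkap_apply, hΛ₀, Matrix.vecMulLinear_apply]
      exact hlb_hc_lin f m (avec k)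
    rcases Fin.eq_zero_or_eq_succ k with rfl | ⟨k, rfl⟩
    · rw [havec, Fin.cons_zero, LinearMap.map_smul, hkap_e₀, smul_eq_mul, inv_mul_cancel₀ hκ₀,
        C_1] at h01
      rw [hpdeg, Fin.cons_zero, hlead, Fin.cons_zero]
      exact ⟨fun j hj => absurd hj (Nat.not_lt_zero _), h01.1⟩
    · have hka : kap (a k) = 0 := LinearMap.mem_ker.mp (hK ▸ haK k)
      rw [havec, Fin.cons_succ, hka, C_0, haΛ k] at h01
      rw [hpdeg, Fin.cons_succ, hlead, Fin.cons_succ]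
      exact ⟨fun j hj => by rw [Nat.lt_one_iff.mp hj]; exact h01.1, h01.2⟩
  -- Step 4: the degree-`δ` monomials in the `w k`; lowest-degree forms `aeval L (x^(tail e))`
  set Q : DegIdx (Fin (N + 1)) δ → MvPolynomial (DegIdx σ m) ℂ := fun e => ∏ k, lin (avec k) ^ e.1 k with hQ
  set n : DegIdx (Fin (N + 1)) δ → ℕ := fun e => ∑ k, e.1 k * pdeg k
  have hP : ∀ e, (∀ j < n e, homogeneousComponent j (G (Q e)) = 0) ∧
      homogeneousComponent (n e) (G (Q e)) = aeval L (monomial (Finsupp.tail e.1) (1 : ℂ)) := by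
    intro e
    have hGQ : G (Q e) = ∏ k, w k ^ (e.1 k) := by simp only [hQ, map_prod, map_pow, hw]
    have h := hlbOrd_prod Finset.univ (fun k => e.1 k * pdeg k) (fun k => w k ^ e.1 k)
      fun k _ => (hlbOrd_pow (hwk k).1 (e.1 k)).1
    rw [hGQ]
    refine ⟨h.1, h.2.trans ?_⟩
    rw [Finset.prod_congr rfl fun k _ => (hlbOrd_pow (hwk k).1 (e.1 k)).2.trans
      (congrArg (· ^ e.1 k) (hwk k).2), Fin.prod_univ_succ, hlead, Fin.cons_zero, one_pow,
      one_mul, aeval_monomial, map_one, one_mul, Finsupp.prod_fintype _ _ (fun i => pow_zero _)]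
    simp only [Fin.cons_succ, Finsupp.tail_apply]
  have hφLI : LinearIndependent ℂ
      (fun e : DegIdx (Fin (N + 1)) δ => aeval L (monomial (Finsupp.tail e.1) (1 : ℂ))) := by
    have htail : Function.Injective (fun e : DegIdx (Fin (N + 1)) δ => Finsupp.tail e.1) := by
      intro e e' h
      have hdeg (u : DegIdx (Fin (N + 1)) δ) : u.1 0 + ∑ k, Finsupp.tail u.1 k = δ := by
        simpa only [Finsupp.degree_eq_sum, Fin.sum_univ_succ, Finsupp.tail_apply] using
          mem_degMonomials_iff.mp u.2
      have ht : Finsupp.tail e.1 = Finsupp.tail e'.1 := h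
      have h1 := hdeg e
      have h2 := hdeg e'
      rw [ht] at h1
      apply Subtype.ext
      rw [← Finsupp.cons_tail e.1, ← Finsupp.cons_tail e'.1, ht, show e.1 0 = e'.1 0 by omega]
    have h := (basisMonomials (Fin N) ℂ).linearIndependent
    rw [coe_basisMonomials] at h
    exact (h.comp _ htail).map' (aeval L).toLinearMap (LinearMap.ker_eq_bot.mpr hinj)
  have hPLI : LinearIndependent ℂ (fun e => G (Q e)) :=
    hlb_linearIndependent_of_initialForms _ _ n hφLI (fun e => (hP e).1) (fun e => (hP e).2)
  -- Step 5: the `Q e` are degree-`δ` forms in the coordinates, and `G = τ ∘ genericOrbitMap`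
  have hQmem : ∀ e, Q e ∈ homogeneousSubmodule (DegIdx σ m) ℂ δ := fun e => by
    rw [mem_homogeneousSubmodule, hQ]
    have h := IsHomogeneous.prod Finset.univ (fun k => lin (avec k) ^ e.1 k) (fun k => 1 * e.1 k)
      fun k _ => IsHomogeneous.pow ((mem_homogeneousSubmodule 1 _).mp (Submodule.sum_mem _
        fun d _ => Submodule.smul_mem _ _ ((mem_homogeneousSubmodule 1 _).mpr
          (isHomogeneous_X ℂ d)))) (e.1 k)
    simp only [one_mul] at h
    rwa [← Finsupp.degree_eq_sum, mem_degMonomials_iff.mp e.2] at h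
  have := finite_homogeneousSubmodule (DegIdx σ m) ℂ δ
  have hfam : LinearIndependent ℂ (fun e : DegIdx (Fin (N + 1)) δ =>
      (⟨genericOrbitMap f m (Q e), Submodule.mem_map_of_mem (hQmem e)⟩ :
        (homogeneousSubmodule (DegIdx σ m) ℂ δ).map (genericOrbitMap f m).toLinearMap)) :=
    LinearIndependent.of_comp (Submodule.subtype _)
      (LinearIndependent.of_comp (hlbτ⟦σ⟧).toLinearMap hPLI)
  have hcard := hfam.fintype_card_le_finrank
  rwa [Fintype.card_coe, degMonomials, Finset.card_finsuppAntidiag_nat_eq_choose, Finset.card_univ,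
    Fintype.card_fin, show N + 1 + δ - 1 = δ + N by omega, Nat.choose_symm_add] at hcard

end

end Summit.ValiantsHypothesis.ValiantsHypothesis.Theorems.ValuativeFlip
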